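import Mathlib
import Literature.NumberTheory.EllipticCurves.ModularCurveKleinJ
import Literature.NumberTheory.Automorphic.GaloisConjugateForms
import Literature.NumberTheory.ModularForms.JacobiThetaGammaTwo
import Literature.NumberTheory.ModularForms.QExpansionAlgebra
import Literature.NumberTheory.Automorphic.ModularLambdaWeightZero

/-!
# Stub `stub_modularOfInvariant` for line `Sketch` (crux stmt-Langlands-8457)

From invariance to a modular form. Let `g : ℍ → ℂ` be holomorphic with `g(τ + 1) = g(τ)`,
`k : ℤ`, and suppose that `y = g¹² / Δᵏ` is invariant under a finite-index subgroup `Γ' ∋ T` of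
`SL(2, ℤ)` and that all translates `y ∘ γ`, `γ ∈ SL(2, ℤ)`, are `≤ K e^{A im τ}` for
`im τ ≥ T₀`. Then (`ModularOfInvariant.exists_modularForm_of_invariant`):

* `(g ∣ₖ γ)(τ)¹² = y(γτ) Δ(τ)ᵏ` for every `γ ∈ SL(2, ℤ)` (`slash_pow_twelve`: the automorphy
  factors of `g¹²` and `Δᵏ` cancel), so for `γ ∈ Γ'` we get `(g ∣ₖ γ)¹² = g¹²`, whence
  `g ∣ₖ γ = ζ • g` with `ζ¹² = 1` (holomorphic functions on `ℍ` have no zero divisors,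
  `UpperHalfPlane.prod_eq_zero_iff`, and `X¹² - Y¹² = ∏_{ζ¹²=1} (X - ζY)`);
* `γ ↦ ζ_γ` is a homomorphism `Γ' → μ₁₂(ℂ)`, so the stabiliser `K` of `g` under `∣ₖ` has finite
  index (`finiteIndex_of_slash_eq_smul`); it contains `T` by periodicity; put `Γ'' = K ⊓ Γ'`;
* for `n = k + 12m ≥ |A|` the function `g Δᵐ` is a `ModularForm Γ'' (k + 12m)`: every translate
  `(g Δᵐ) ∣ γ = (g ∣ₖ γ) Δᵐ` has `‖·‖¹² = ‖y(γτ)‖ ‖Δ τ‖ⁿ ≤ K Cⁿ e^{(A - 2πn) im τ} ≤ K Cⁿ`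
  (`isBoundedAtImInfty_mul_discriminant_pow`), so it is bounded at every cusp.

For the registered stub (`stub_modularOfInvariant`) `g = Σ bₙ qⁿ` is a convergent `q`-series, hence
bounded at `i∞` (`UpperHalfPlane.isBoundedAtImInfty_of_hasSum_qExpansion`), and
`qExpansion 1 (g Δᵐ) = qExpansion 1 g · (qExpansion 1 Δ)ᵐ` by multiplicativity of `qExpansion` on
periodic holomorphic functions bounded at `i∞`.
-/

open scoped MatrixGroups Manifold Topology ModularForm Real
open UpperHalfPlane CongruenceSubgroup Metric PowerSeries
open Literature.NumberTheory.Automorphic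
open Literature.NumberTheory.EllipticCurves Literature.NumberTheory.EllipticCurves.ModularForms
open Literature.NumberTheory.ModularForms (slash_T_apply)
open Literature.NumberTheory.ModularForms.QExpansionAlgebra

set_option linter.dupNamespace false -- project-wide option (lakefile weak.linter.dupNamespace); `Summit.Langlands.Langlands` is the mandated namespace

noncomputable section

namespace Summit.Langlands.Langlands.Theorems.CapacityClassicality

namespace ModularOfInvariant

/-! ## The automorphy factors of `g¹²` and `Δᵏ` cancel -/

/-- For `γ ∈ SL(2, ℤ)`: `(g ∣ₖ γ)(τ)¹² = (g(γτ)¹² / Δ(γτ)ᵏ) · Δ(τ)ᵏ`, because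
`(g ∣ₖ γ)(τ) = g(γτ) (cτ+d)⁻ᵏ` and `Δ(γτ) = (cτ+d)¹² Δ(τ)`. [folklore] -/
theorem slash_pow_twelve (g : ℍ → ℂ) (k : ℤ) (γ : SL(2, ℤ)) (τ : ℍ) :
    ((g ∣[k] γ) τ) ^ 12 =
      g (γ • τ) ^ 12 / ModularForm.discriminant (γ • τ) ^ k * ModularForm.discriminant τ ^ k := by
  have hd : denom (γ : GL (Fin 2) ℝ) τ ≠ 0 := denom_ne_zero _ τ
  have hΔ : ModularForm.discriminant τ ≠ 0 := ModularForm.discriminant_ne_zero τ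
  have h1 : (denom (γ : GL (Fin 2) ℝ) τ ^ (-k)) ^ 12 =
      (denom (γ : GL (Fin 2) ℝ) τ ^ (12 * k))⁻¹ := by
    rw [← zpow_natCast, ← zpow_mul, ← zpow_neg]
    congr 1
    push_cast
    ring
  have h2 : (denom (γ : GL (Fin 2) ℝ) τ ^ (12 : ℤ) * ModularForm.discriminant τ) ^ k =
      denom (γ : GL (Fin 2) ℝ) τ ^ (12 * k) * ModularForm.discriminant τ ^ k := by
    rw [mul_zpow, ← zpow_mul]
  rw [ModularForm.SL_slash_apply, mul_pow, h1, discriminant_apply_smul, h2]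
  have h3 : denom (γ : GL (Fin 2) ℝ) τ ^ (12 * k) ≠ 0 := zpow_ne_zero _ hd
  have h4 : ModularForm.discriminant τ ^ k ≠ 0 := zpow_ne_zero _ hΔ
  field_simp

/-! ## Twelfth roots -/

/-- Two holomorphic functions on `ℍ` with `h¹² = g¹²` differ by a twelfth root of unity:
`X¹² - Y¹² = ∏_{ζ¹² = 1} (X - ζ Y)` and holomorphic functions on the (connected) upper half plane
have no zero divisors. [folklore] -/
theorem exists_eq_smul_of_pow_twelve_eq {g h : ℍ → ℂ} (hg : MDiff g) (hh : MDiff h)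
    (H : ∀ τ, h τ ^ 12 = g τ ^ 12) : ∃ ζ : ℂ, ζ ^ 12 = 1 ∧ h = ζ • g := by
  have hprod : ∏ ζ ∈ Polynomial.nthRootsFinset 12 (1 : ℂ), (h - ζ • g) = 0 := by
    funext τ
    have key := (Complex.isPrimitiveRoot_exp 12 (by norm_num)).pow_sub_pow_eq_prod_sub_mul
      (h τ) (g τ) (by norm_num)
    rw [H τ, sub_self] at key
    rw [Finset.prod_apply, Pi.zero_apply]
    simpa only [Pi.sub_apply, Pi.smul_apply, smul_eq_mul] using key.symm
  obtain ⟨ζ, hζ, hζ0⟩ := (UpperHalfPlane.prod_eq_zero_iff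
    (s := Polynomial.nthRootsFinset 12 (1 : ℂ)) (f := fun ζ ↦ h - ζ • g)
    fun ζ _ ↦ hh.sub (hg.const_smul ζ)).mp hprod
  exact ⟨ζ, (Polynomial.mem_nthRootsFinset (by norm_num) (1 : ℂ)).mp hζ, sub_eq_zero.mp hζ0⟩

/-! ## The stabiliser has finite index -/

/-- If `g ∣ₖ γ = ζ_γ • g` with `ζ_γ¹² = 1` for all `γ` in a finite-index subgroup `Γ'`, then the
stabiliser `K = {A | g ∣ₖ A = g}` has finite index in `SL(2, ℤ)`: for `g ≠ 0`, `γ ↦ ζ_γ` is a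
homomorphism `Γ' → μ₁₂(ℂ)` whose kernel lies in `K`. [folklore] -/
theorem finiteIndex_of_slash_eq_smul (g : ℍ → ℂ) (k : ℤ) (Γ' : Subgroup SL(2, ℤ))
    [Γ'.FiniteIndex] (hroot : ∀ γ ∈ Γ', ∃ ζ : ℂ, ζ ^ 12 = 1 ∧ g ∣[k] γ = ζ • g)
    (K : Subgroup SL(2, ℤ)) (hK : ∀ A : SL(2, ℤ), A ∈ K ↔ g ∣[k] A = g) : K.FiniteIndex := by
  by_cases hg0 : g = 0
  · refine Subgroup.finiteIndex_of_le (H := ⊤) fun A _ ↦ (hK A).mpr ?_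
    rw [hg0, SlashAction.zero_slash]
  obtain ⟨τ₀, hτ₀⟩ : ∃ τ₀, g τ₀ ≠ 0 := Function.ne_iff.mp hg0
  have huniq : ∀ a c : ℂ, a • g = c • g → a = c := fun a c hac ↦ by
    have := congrFun hac τ₀
    simp only [Pi.smul_apply, smul_eq_mul] at this
    exact mul_right_cancel₀ hτ₀ this
  choose! ζ hζ1 hζg using hroot
  have hmul : ∀ γ ∈ Γ', ∀ δ ∈ Γ', ζ (γ * δ) = ζ γ * ζ δ := fun γ hγ δ hδ ↦ by
    apply huniq
    rw [← hζg _ (mul_mem hγ hδ), SlashAction.slash_mul, hζg γ hγ, ModularForm.SL_smul_slash,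
      hζg δ hδ, smul_smul]
  have hone : ζ 1 = 1 :=
    huniq _ _ (by rw [← hζg 1 (one_mem Γ'), SlashAction.slash_one, one_smul])
  haveI : NeZero (12 : ℕ) := ⟨by norm_num⟩
  let φ : Γ' →* rootsOfUnity 12 ℂ :=
    { toFun := fun γ ↦ rootsOfUnity.mkOfPowEq (ζ γ) (hζ1 γ γ.2)
      map_one' := by
        apply rootsOfUnity.coe_injective
        simp [hone]
      map_mul' := fun γ δ ↦ by
        apply rootsOfUnity.coe_injective
        simp [hmul γ γ.2 δ δ.2] }
  have hle : φ.ker.map Γ'.subtype ≤ K := by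
    intro A hA
    obtain ⟨γ, hγ, rfl⟩ := Subgroup.mem_map.mp hA
    rw [MonoidHom.mem_ker] at hγ
    have hζ : ζ γ = 1 := by
      have := congrArg (fun u : rootsOfUnity 12 ℂ ↦ ((u : ℂˣ) : ℂ)) hγ
      simpa [φ] using this
    rw [hK, Subgroup.coe_subtype, hζg γ γ.2, hζ, one_smul]
  haveI : (φ.ker.map Γ'.subtype).FiniteIndex := ⟨by
    rw [Subgroup.index_map_subtype]
    exact mul_ne_zero Subgroup.FiniteIndex.index_ne_zero Subgroup.FiniteIndex.index_ne_zero⟩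
  exact Subgroup.finiteIndex_of_le hle

/-! ## Growth at `i∞` -/

/-- `‖Δ τ‖ ≤ C e^{-2π im τ}` for `im τ` large (`Δ` is a cusp form of level one). [folklore] -/
theorem exists_norm_discriminant_le :
    ∃ C T₁ : ℝ, ∀ τ : ℍ, T₁ ≤ τ.im →
      ‖ModularForm.discriminant τ‖ ≤ C * Real.exp (-(2 * π * τ.im)) := by
  have h := CuspFormClass.exp_decay_atImInfty (h := 1) CuspForm.discriminant one_pos
    one_mem_strictPeriods_SL
  rw [Asymptotics.isBigO_iff] at h
  obtain ⟨C, hC⟩ := h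
  obtain ⟨T₁, hT₁⟩ := (atImInfty_mem _).mp hC
  refine ⟨C, T₁, fun τ hτ ↦ ?_⟩
  have := hT₁ τ hτ
  simp only [Set.mem_setOf_eq, div_one, Real.norm_eq_abs, Real.abs_exp] at this
  simpa [neg_mul] using this

/-- If `‖F τ‖¹² ≤ M` for `im τ ≥ T`, then `F` is bounded at `i∞`. [folklore] -/
theorem isBoundedAtImInfty_of_pow_twelve_le {F : ℍ → ℂ} (M T : ℝ)
    (h : ∀ τ : ℍ, T ≤ τ.im → ‖F τ‖ ^ 12 ≤ M) : IsBoundedAtImInfty F := by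
  rw [isBoundedAtImInfty_iff]
  refine ⟨max 1 M, T, fun τ hτ ↦ ?_⟩
  by_cases h1 : ‖F τ‖ ≤ 1
  · exact h1.trans (le_max_left _ _)
  · have h1' : 1 ≤ ‖F τ‖ := (not_le.mp h1).le
    calc ‖F τ‖ ≤ ‖F τ‖ ^ 12 := le_self_pow₀ h1' (by norm_num)
      _ ≤ M := h τ hτ
      _ ≤ max 1 M := le_max_right _ _

/-- **Growth ⇒ boundedness.** If `G¹² = y · Δᵏ` on `ℍ` with `‖y τ‖ ≤ K e^{A im τ}` and
`‖Δ τ‖ ≤ C e^{-2π im τ}` for `im τ` large, and `n = k + 12 m ≥ A` (`n : ℕ`), then `G · Δᵐ` is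
bounded at `i∞`: `‖G Δᵐ‖¹² = ‖y‖ ‖Δ‖ⁿ ≤ K Cⁿ e^{(A - 2πn) im τ} ≤ K Cⁿ`. [folklore] -/
theorem isBoundedAtImInfty_mul_discriminant_pow {G y : ℍ → ℂ} {k : ℤ} {m n : ℕ}
    {A K C T₀ T₁ : ℝ} (hn : k + 12 * (m : ℤ) = n) (hA : A ≤ n)
    (hI : ∀ τ : ℍ, G τ ^ 12 = y τ * ModularForm.discriminant τ ^ k)
    (hy : ∀ τ : ℍ, T₀ ≤ τ.im → ‖y τ‖ ≤ K * Real.exp (A * τ.im))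
    (hΔ : ∀ τ : ℍ, T₁ ≤ τ.im → ‖ModularForm.discriminant τ‖ ≤ C * Real.exp (-(2 * π * τ.im))) :
    IsBoundedAtImInfty (G * ModularForm.discriminant ^ m) := by
  refine isBoundedAtImInfty_of_pow_twelve_le (K * C ^ n) (max T₀ T₁) fun τ hτ ↦ ?_
  have hyτ := hy τ ((le_max_left _ _).trans hτ)
  have hΔτ := hΔ τ ((le_max_right _ _).trans hτ)
  have hK0 : 0 ≤ K := by
    by_contra hK
    have : K * Real.exp (A * τ.im) < 0 := mul_neg_of_neg_of_pos (not_le.mp hK) (Real.exp_pos _)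
    linarith [norm_nonneg (y τ)]
  have hC0 : 0 ≤ C := by
    by_contra hC
    have : C * Real.exp (-(2 * π * τ.im)) < 0 :=
      mul_neg_of_neg_of_pos (not_le.mp hC) (Real.exp_pos _)
    linarith [norm_nonneg (ModularForm.discriminant τ)]
  have hval : (G * ModularForm.discriminant ^ m) τ ^ 12 = y τ * ModularForm.discriminant τ ^ n := by
    have h12 : (ModularForm.discriminant τ ^ m) ^ 12 = ModularForm.discriminant τ ^ ((12 * m : ℕ) : ℤ) := by
      rw [zpow_natCast, pow_mul']
    rw [Pi.mul_apply, Pi.pow_apply, mul_pow, hI, h12, mul_assoc,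
      ← zpow_add₀ (ModularForm.discriminant_ne_zero τ), ← zpow_natCast _ n, ← hn]
    push_cast
    ring_nf
  have hexp : Real.exp (A * τ.im) * Real.exp (-(2 * π * τ.im)) ^ n ≤ 1 := by
    rw [← Real.exp_nat_mul, ← Real.exp_add, Real.exp_le_one_iff]
    have hn0 : (0 : ℝ) ≤ n := n.cast_nonneg
    have hτ0 : 0 < τ.im := τ.im_pos
    nlinarith [Real.pi_gt_three, mul_nonneg hn0 hτ0.le]
  calc ‖(G * ModularForm.discriminant ^ m) τ‖ ^ 12
      = ‖y τ‖ * ‖ModularForm.discriminant τ‖ ^ n := by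
        rw [← norm_pow, hval, norm_mul, norm_pow]
    _ ≤ (K * Real.exp (A * τ.im)) * (C * Real.exp (-(2 * π * τ.im))) ^ n :=
        mul_le_mul hyτ (pow_le_pow_left₀ (norm_nonneg _) hΔτ n) (pow_nonneg (norm_nonneg _) n)
          (mul_nonneg hK0 (Real.exp_pos _).le)
    _ = K * C ^ n * (Real.exp (A * τ.im) * Real.exp (-(2 * π * τ.im)) ^ n) := by
        rw [mul_pow]; ring
    _ ≤ K * C ^ n * 1 := mul_le_mul_of_nonneg_left hexp (mul_nonneg hK0 (pow_nonneg hC0 n))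
    _ = K * C ^ n := mul_one _

/-! ## From invariance to a modular form -/

/-- **From invariance to a modular form (generic form).** Let `g` be holomorphic on `ℍ` with
`g(τ + 1) = g(τ)`, and suppose `y = g¹² / Δᵏ` is invariant under a finite-index `Γ' ∋ T` and all
`SL₂(ℤ)`-translates of `y` grow at most like `K e^{A im τ}` at `i∞`. Then for some finite-index
`Γ'' ∋ T` and some `m`, `g · Δᵐ` is (the function of) a `ModularForm Γ'' (k + 12 m)`. [folklore] -/
theorem exists_modularForm_of_invariant (g : ℍ → ℂ) (hg : MDiff g) (k : ℤ)
    (hgper : ∀ τ : ℍ, g ((1 : ℝ) +ᵥ τ) = g τ)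
    (Γ' : Subgroup SL(2, ℤ)) [Γ'.FiniteIndex] (hT : ModularGroup.T ∈ Γ')
    (hinv : ∀ γ ∈ Γ', ∀ τ : ℍ,
      g (γ • τ) ^ 12 / ModularForm.discriminant (γ • τ) ^ k =
        g τ ^ 12 / ModularForm.discriminant τ ^ k)
    (A K T₀ : ℝ)
    (hgrowth : ∀ (γ : SL(2, ℤ)) (τ : ℍ), T₀ ≤ τ.im →
      ‖g (γ • τ) ^ 12 / ModularForm.discriminant (γ • τ) ^ k‖ ≤ K * Real.exp (A * τ.im)) :
    ∃ (Γ'' : Subgroup SL(2, ℤ)) (_ : Γ''.FiniteIndex) (m : ℕ)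
      (f : ModularForm (Γ'' : Subgroup (GL (Fin 2) ℝ)) (k + 12 * m)),
      ModularGroup.T ∈ Γ'' ∧ ⇑f = g * ModularForm.discriminant ^ m := by
  -- twelfth roots: `g ∣ₖ γ = ζ • g` on `Γ'`
  have hroot : ∀ γ ∈ Γ', ∃ ζ : ℂ, ζ ^ 12 = 1 ∧ g ∣[k] γ = ζ • g := fun γ hγ ↦
    exists_eq_smul_of_pow_twelve_eq hg (hg.slash k (γ : GL (Fin 2) ℝ)) fun τ ↦ by
      rw [slash_pow_twelve, hinv γ hγ τ,
        div_mul_cancel₀ _ (zpow_ne_zero _ (ModularForm.discriminant_ne_zero τ))]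
  -- the stabiliser `K` of `g` and the level `Γ'' = K ⊓ Γ'`
  obtain ⟨K₀, hK₀⟩ := ModularLambda.exists_subgroup_slash_eq g k
  haveI : K₀.FiniteIndex := finiteIndex_of_slash_eq_smul g k Γ' hroot K₀ hK₀
  have hTK₀ : ModularGroup.T ∈ K₀ := by
    rw [hK₀]
    funext τ
    rw [slash_T_apply, hgper]
  -- the weight shift `m` and `n = k + 12 m`
  obtain ⟨m, n, hn, hAn⟩ : ∃ m n : ℕ, k + 12 * (m : ℤ) = n ∧ A ≤ n := by
    have h0 : (0 : ℤ) ≤ k + 12 * ((⌈|A|⌉₊ + k.natAbs : ℕ) : ℤ) := by omega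
    refine ⟨⌈|A|⌉₊ + k.natAbs, (k + 12 * ((⌈|A|⌉₊ + k.natAbs : ℕ) : ℤ)).toNat, ?_, ?_⟩
    · exact (Int.toNat_of_nonneg h0).symm
    · have h1 : ⌈|A|⌉₊ ≤ (k + 12 * ((⌈|A|⌉₊ + k.natAbs : ℕ) : ℤ)).toNat := by omega
      calc A ≤ |A| := le_abs_self A
        _ ≤ ⌈|A|⌉₊ := Nat.le_ceil _
        _ ≤ _ := by exact_mod_cast h1
  -- boundedness of all translates
  obtain ⟨C, T₁, hΔ⟩ := exists_norm_discriminant_le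
  have hΔm : ∀ γ : SL(2, ℤ), (ModularForm.discriminant ^ m) ∣[(12 * (m : ℤ))] γ =
      ModularForm.discriminant ^ m := fun γ ↦ by
    have := SlashInvariantForm.slash_action_eqn
      ((ModularFormClass.modularForm CuspForm.discriminant).pow m) (γ : GL (Fin 2) ℝ) ⟨γ, rfl⟩
    rw [mul_comm]
    simpa [ModularForm.SL_slash] using this
  have hbdd : ∀ γ : SL(2, ℤ),
      IsBoundedAtImInfty ((g * ModularForm.discriminant ^ m) ∣[k + 12 * (m : ℤ)] γ) := by
    intro γ
    rw [ModularForm.mul_slash_SL2, hΔm]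
    exact isBoundedAtImInfty_mul_discriminant_pow
      (y := fun τ ↦ g (γ • τ) ^ 12 / ModularForm.discriminant (γ • τ) ^ k) hn hAn
      (fun τ ↦ slash_pow_twelve g k γ τ) (hgrowth γ) hΔ
  -- the form
  let f : ModularForm ((K₀ ⊓ Γ' : Subgroup SL(2, ℤ)) : Subgroup (GL (Fin 2) ℝ)) (k + 12 * m) :=
    { toFun := g * ModularForm.discriminant ^ m
      slash_action_eq' := by
        intro γ hγ
        obtain ⟨A', hA', rfl⟩ := Subgroup.mem_map.mp hγ
        have hA'K : g ∣[k] A' = g := (hK₀ A').mp (Subgroup.mem_inf.mp hA').1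
        show (g * ModularForm.discriminant ^ m) ∣[k + 12 * (m : ℤ)] A' =
          g * ModularForm.discriminant ^ m
        rw [ModularForm.mul_slash_SL2, hΔm, hA'K]
      holo' := hg.mul ((ModularFormClass.holo CuspForm.discriminant).pow m)
      bdd_at_cusps' := by
        intro c hc
        rw [Subgroup.IsArithmetic.isCusp_iff_isCusp_SL2Z] at hc
        rw [OnePoint.isBoundedAt_iff_forall_SL2Z hc]
        intro γ _
        exact hbdd γ }
  exact ⟨K₀ ⊓ Γ', inferInstance, m, f, Subgroup.mem_inf.mpr ⟨hTK₀, hT⟩, rfl⟩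

end ModularOfInvariant

/-- **Registered stub `stub_modularOfInvariant`** (line `Sketch`, crux stmt-Langlands-8457).
**From invariance to a modular form.** Let `g = Σ bₙqⁿ` be holomorphic and `1`-periodic on `ℍ`
(a convergent `q`-series with `qExpansion 1 g = Σ bₙ qⁿ`) and suppose `y = g¹²/Δᵏ` is invariant
under a finite-index `Γ' ∋ T` with all `SL₂(ℤ)`-translates of exponential growth. Then
`g|_kγ = ζ_γ g` (`ζ_γ¹² = 1`) on `Γ'`, the kernel of `ζ` has finite index and contains `T`, and for
`m` large `g·Δᵐ` is a `ModularForm Γ'' (k + 12m)` on a finite-index `Γ'' ∋ T` whose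
`q`-expansion is `(Σ bₙqⁿ)·Δᵐ`. [folklore] -/
theorem stub_modularOfInvariant (b : ℕ → ℂ) (k : ℤ)
    (hg : MDifferentiable 𝓘(ℂ, ℂ) 𝓘(ℂ, ℂ)
      (fun τ : ℍ ↦ ∑' n : ℕ, b n * Function.Periodic.qParam 1 (τ : ℂ) ^ n))
    (hgper : ∀ τ : ℍ, (∑' n : ℕ, b n * Function.Periodic.qParam 1 (((1 : ℝ) +ᵥ τ : ℍ) : ℂ) ^ n) =
      ∑' n : ℕ, b n * Function.Periodic.qParam 1 (τ : ℂ) ^ n)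
    (hgsum : ∀ τ : ℍ, HasSum (fun n : ℕ ↦ b n * Function.Periodic.qParam 1 (τ : ℂ) ^ n)
      (∑' n : ℕ, b n * Function.Periodic.qParam 1 (τ : ℂ) ^ n))
    (hgq : qExpansion 1 (fun τ : ℍ ↦ ∑' n : ℕ, b n * Function.Periodic.qParam 1 (τ : ℂ) ^ n) =
      PowerSeries.mk b)
    (Γ' : Subgroup SL(2, ℤ)) [Γ'.FiniteIndex] (hT : ModularGroup.T ∈ Γ')
    (hinv : ∀ γ ∈ Γ', ∀ τ : ℍ,
      (∑' n : ℕ, b n * Function.Periodic.qParam 1 ((γ • τ : ℍ) : ℂ) ^ n) ^ 12 /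
          ModularForm.discriminant (γ • τ) ^ k =
        (∑' n : ℕ, b n * Function.Periodic.qParam 1 (τ : ℂ) ^ n) ^ 12 /
          ModularForm.discriminant τ ^ k)
    (A K T₀ : ℝ)
    (hgrowth : ∀ (γ : SL(2, ℤ)) (τ : ℍ), T₀ ≤ τ.im →
      ‖(∑' n : ℕ, b n * Function.Periodic.qParam 1 ((γ • τ : ℍ) : ℂ) ^ n) ^ 12 /
          ModularForm.discriminant (γ • τ) ^ k‖ ≤ K * Real.exp (A * τ.im)) :
    ∃ (Γ'' : Subgroup SL(2, ℤ)) (_ : Γ''.FiniteIndex) (m : ℕ)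
      (f : ModularForm (Γ'' : Subgroup (GL (Fin 2) ℝ)) (k + 12 * m)),
      ModularGroup.T ∈ Γ'' ∧
        qExpansion 1 ⇑f = PowerSeries.mk b * (qExpansion 1 ⇑CuspForm.discriminant) ^ m := by
  obtain ⟨Γ'', hΓ'', m, f, hT'', hf⟩ := ModularOfInvariant.exists_modularForm_of_invariant
    (fun τ : ℍ ↦ ∑' n : ℕ, b n * Function.Periodic.qParam 1 (τ : ℂ) ^ n) hg k hgper Γ' hT hinv
    A K T₀ hgrowth
  refine ⟨Γ'', hΓ'', m, f, hT'', ?_⟩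
  -- `g` and `Δ` are nice of period `1`
  have hgnice : Function.Periodic
      ((fun τ : ℍ ↦ ∑' n : ℕ, b n * Function.Periodic.qParam 1 (τ : ℂ) ^ n) ∘ ofComplex)
        ((1 : ℝ) : ℂ) ∧
      MDiff (fun τ : ℍ ↦ ∑' n : ℕ, b n * Function.Periodic.qParam 1 (τ : ℂ) ^ n) ∧
      IsBoundedAtImInfty (fun τ : ℍ ↦ ∑' n : ℕ, b n * Function.Periodic.qParam 1 (τ : ℂ) ^ n) :=
    ⟨ModularLambda.periodic_comp_ofComplex_of_vadd hgper, hg,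
      isBoundedAtImInfty_of_hasSum_qExpansion one_pos fun τ ↦ by
        simpa only [smul_eq_mul] using hgsum τ⟩
  have hΔnice : Function.Periodic (ModularForm.discriminant ∘ ofComplex) ((1 : ℝ) : ℂ) ∧
      MDiff ModularForm.discriminant ∧ IsBoundedAtImInfty ModularForm.discriminant :=
    ⟨SlashInvariantFormClass.periodic_comp_ofComplex CuspForm.discriminant
        one_mem_strictPeriods_SL,
      ModularFormClass.holo CuspForm.discriminant, ModularFormClass.bdd_at_infty CuspForm.discriminant⟩
  rw [hf, qExpansion_mul_of_nice one_pos hgnice (nice_pow hΔnice m),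
    qExpansion_pow_of_nice one_pos hΔnice, hgq]
  rfl

end Summit.Langlands.Langlands.Theorems.CapacityClassicality

end
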